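import Summits.ValiantsHypothesis.ValiantsHypothesis.Theorems.DepthWindowRefreshTools

/-!
# Route `DepthWindow` — the REFRESH level of the universal slope-2 builder

Cone-free theorem (decomp-valiant lens 4, g16) supporting the crux item `HomImmHardTwoOne`
(stmt-ValiantsHypothesis-30635).  Level `2i+2` of the round `TwoLevelRound` (`DepthWindowULBReduction`): a word
`z` (the group sums of the extraction level) with `|z_j| ≤ h` whose POSITIVE letters above the precision `e` have
total `≤ 17h` and do not outweigh the negative letters below `−e` is regrouped — one group `N₀` = all letters
`> e` + greedily absorbed letters `< −e` + a trim, one trimmed group per remaining letter `< −e`, singletons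
else —
so that every group has mass `≤ 64h` and sum of modulus `≤ h`, and the groups whose sum still has modulus `> e`
(«HOLD») have total modulus `≤ |Σ z|`: the one-sided drift of the trimming goods is paid for by the total sum.

* `exists_refresh_core` — the statement above, the grouping recorded as an idempotent leader map.

References: [LimayeSrinivasanTavenas2022] full version ECCC TR22-090, Lemma 21 / Algorithm 1, footnote 11;
[BhargavDuttaSaxena2024] ACM ToCT 16(4):23 §5.
-/

-- layout Summits/ValiantsHypothesis/ValiantsHypothesis forces the duplicated namespace component
set_option linter.dupNamespace false

namespace Summit.ValiantsHypothesis.ValiantsHypothesis.Theorems.DepthWindow.TreeBias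

open Finset

variable {n : ℕ}

/-- **The refresh level (core, positive-minority form).**  See the module docstring. [folklore] -/
theorem exists_refresh_core (z : Fin n → ℤ) {h e : ℕ} (hz : ∀ j, |z j| ≤ h)
    (hQ : ∑ j ∈ univ.filter (fun j => (e : ℤ) < z j), z j ≤ 17 * h)
    (hQQ : ∑ j ∈ univ.filter (fun j => (e : ℤ) < z j), z j +
      ∑ j ∈ univ.filter (fun j => z j < -(e : ℤ)), z j ≤ 0) :
    ∃ L : Fin n → Fin n, (∀ i, L (L i) = L i) ∧
      (∀ i, ∑ j ∈ univ.filter (fun j => L j = L i), |z j| ≤ 64 * h) ∧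
      (∀ i, |∑ j ∈ univ.filter (fun j => L j = L i), z j| ≤ h) ∧
      ∑ i ∈ univ.filter (fun i => L i = i ∧ (e : ℤ) < |∑ j ∈ univ.filter (fun j => L j = i), z j|),
          |∑ j ∈ univ.filter (fun j => L j = i), z j| ≤ |∑ j, z j| := by
  classical
  -- the four kinds of letters
  set P := univ.filter (fun j => (e : ℤ) < z j) with hP
  set Nn := univ.filter (fun j => z j < -(e : ℤ)) with hNn
  set Pool := univ.filter (fun j => 0 ≤ z j ∧ z j ≤ (e : ℤ)) with hPool
  set Gm := univ.filter (fun j => -(e : ℤ) ≤ z j ∧ z j < 0) with hGm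
  have he0 : (0 : ℤ) ≤ e := Nat.cast_nonneg e
  have hzlo : ∀ j, -(h : ℤ) ≤ z j := fun j => (abs_le.1 (hz j)).1
  have hzhi : ∀ j, z j ≤ h := fun j => (abs_le.1 (hz j)).2
  have hdPN : Disjoint P Nn := by
    rw [hP, hNn]; exact disjoint_filter.2 fun j _ h1 h2 => by linarith
  have hsplit : ∑ j, z j = ∑ j ∈ P, z j + ∑ j ∈ Nn, z j + ∑ j ∈ Pool, z j + ∑ j ∈ Gm, z j := by
    have hd1 : Disjoint P Nn := hdPN
    have hd2 : Disjoint (P ∪ Nn) Pool := by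
      rw [disjoint_union_left]
      exact ⟨disjoint_filter.2 fun j _ h1 h2 => by linarith, disjoint_filter.2 fun j _ h1 h2 => by linarith⟩
    have hd3 : Disjoint (P ∪ Nn ∪ Pool) Gm := by
      rw [disjoint_union_left, disjoint_union_left]
      exact ⟨⟨disjoint_filter.2 fun j _ h1 h2 => by linarith, disjoint_filter.2 fun j _ h1 h2 => by linarith⟩,
        disjoint_filter.2 fun j _ h1 h2 => by linarith⟩
    have hu : univ = P ∪ Nn ∪ Pool ∪ Gm := by
      ext j; simp only [mem_univ, mem_union, mem_filter, hP, hNn, hPool, hGm, true_and, true_iff]; omega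
    rw [← sum_union hd1, ← sum_union hd2, ← sum_union hd3, ← hu]
  set Q := ∑ j ∈ P, z j with hQdef
  have hQ0 : 0 ≤ Q := sum_nonneg fun j hj => by have := (mem_filter.1 hj).2; linarith
  have hGm0 : ∑ j ∈ Gm, z j ≤ 0 := sum_nonpos fun j hj => (mem_filter.1 hj).2.2.le
  -- degenerate case: no letter above the precision
  rcases (P ∪ Nn).eq_empty_or_nonempty with hPN | hPN
  · have hsmall : ∀ j, |z j| ≤ e := by
      intro j
      have h1 : j ∉ P := fun h => by
        have : j ∈ P ∪ Nn := mem_union_left Nn h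
        rw [hPN] at this; simp at this
      have h2 : j ∉ Nn := fun h => by
        have : j ∈ P ∪ Nn := mem_union_right P h
        rw [hPN] at this; simp at this
      rw [hP, mem_filter, not_and, not_lt] at h1
      rw [hNn, mem_filter, not_and, not_lt] at h2
      exact abs_le.2 ⟨h2 (mem_univ j), h1 (mem_univ j)⟩
    refine ⟨id, fun i => rfl, fun i => ?_, fun i => ?_, ?_⟩
    · have : univ.filter (fun j => (id j : Fin n) = id i) = {i} := by ext j; simp
      rw [this, sum_singleton]
      have := hz i; have := abs_nonneg (z i); linarith
    · have : univ.filter (fun j => (id j : Fin n) = id i) = {i} := by ext j; simp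
      rw [this, sum_singleton]; exact hz i
    · have : univ.filter (fun i => (id i : Fin n) = i ∧
          (e : ℤ) < |∑ j ∈ univ.filter (fun j => (id j : Fin n) = i), z j|) = ∅ := by
        refine filter_false_of_mem fun i _ => ?_
        have hs : univ.filter (fun j => (id j : Fin n) = i) = {i} := by ext j; simp
        rw [hs, sum_singleton]; exact fun h => not_lt.2 (hsmall i) h.2
      rw [this, sum_empty]; exact abs_nonneg _
  -- greedy absorption of negative letters into the positive block
  obtain ⟨T, hTN, hs₀lo, hs₀hi, hN₀⟩ : ∃ T ⊆ Nn,
      -(h : ℤ) ≤ Q + ∑ j ∈ T, z j ∧ Q + ∑ j ∈ T, z j ≤ 0 ∧ (P ∪ T).Nonempty := by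
    obtain ⟨T, hTN, hT⟩ := exists_greedy_absorb z hQ0 Nn (h := h) fun j _ => hzlo j
    rcases hT with ⟨hTeq, hpos⟩ | ⟨hlo, hhi⟩
    · exfalso; rw [hTeq] at hpos; linarith
    · rcases (P ∪ T).eq_empty_or_nonempty with hPT | hPT
      · -- `P = T = ∅`: absorb one negative letter by hand
        have hP0 : P = ∅ := subset_empty.1 (hPT ▸ subset_union_left)
        have hQz : Q = 0 := by rw [hQdef, hP0, sum_empty]
        obtain ⟨m, hm⟩ : Nn.Nonempty := by
          rcases Nn.eq_empty_or_nonempty with h0 | h0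
          · rw [hP0, h0, union_empty] at hPN; exact absurd rfl hPN.ne_empty
          · exact h0
        refine ⟨{m}, singleton_subset_iff.2 hm, ?_, ?_, ⟨m, mem_union_right _ (mem_singleton_self m)⟩⟩
        · rw [sum_singleton, hQz, zero_add]; exact hzlo m
        · rw [sum_singleton, hQz, zero_add]; have := (mem_filter.1 hm).2; linarith
      · exact ⟨T, hTN, hlo, hhi, hPT⟩
  set s₀ := Q + ∑ j ∈ T, z j with hs₀def
  set a₀ := (P ∪ T).min' hN₀ with ha₀def
  have ha₀ : a₀ ∈ P ∪ T := min'_mem _ hN₀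
  set X := Nn \ T with hXdef
  -- start values of the targets: `s₀` for the block (represented by `a₀`), `z x` for `x ∈ X`
  let s : Fin n → ℤ := fun j => if j = a₀ then s₀ else z j
  have hPpos : ∀ j ∈ P, (e : ℤ) < z j := fun j hj => (mem_filter.1 hj).2
  have hNneg : ∀ j ∈ Nn, z j < -(e : ℤ) := fun j hj => (mem_filter.1 hj).2
  have hPT_notPool : ∀ j ∈ P ∪ T, j ∉ Pool := by
    intro j hj hjp
    have hp := (mem_filter.1 hjp).2
    rcases mem_union.1 hj with h1 | h1
    · have := hPpos j h1; linarith
    · have := hNneg j (hTN h1); linarith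
  have hX_notPool : ∀ x ∈ X, x ∉ Pool := fun x hx hxp => by
    have := hNneg x (mem_sdiff.1 hx).1; have := (mem_filter.1 hxp).2; linarith
  have hX_notPT : ∀ x ∈ X, x ∉ P ∪ T := by
    intro x hx hxPT
    rcases mem_union.1 hxPT with h1 | h1
    · have := hPpos x h1; have := hNneg x (mem_sdiff.1 hx).1; linarith
    · exact (mem_sdiff.1 hx).2 h1
  have ha₀X : a₀ ∉ X := fun h => hX_notPT a₀ h ha₀
  have hXa₀ : ∀ x ∈ X, x ≠ a₀ := fun x hx h => ha₀X (h ▸ hx)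
  set Tg := insert a₀ X with hTgdef
  have hsTg : ∀ t ∈ Tg, s t ≤ 0 := by
    intro t ht
    rcases mem_insert.1 ht with rfl | ht
    · simp [s, hs₀hi]
    · simp only [s, if_neg (hXa₀ t ht)]; have := hNneg t (mem_sdiff.1 ht).1; linarith
  have hdisj : Disjoint Tg Pool := by
    rw [hTgdef, disjoint_insert_left]
    exact ⟨hPT_notPool a₀ ha₀, disjoint_left.2 fun x hx hxp => hX_notPool x hx hxp⟩
  obtain ⟨τ, Used, hUP, hτ, hprop⟩ := exists_multiTrim z s e Tg hsTg Pool hdisj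
    (fun j hj => (mem_filter.1 hj).2.1) (fun j hj => (mem_filter.1 hj).2.2)
  have hUsed_notPT : ∀ j ∈ Used, j ∉ P ∪ T := fun j hj h => hPT_notPool j h (hUP hj)
  have hUsed0 : ∀ j ∈ Used, 0 ≤ z j := fun j hj => (mem_filter.1 (hUP hj)).2.1
  have hτne : ∀ j ∈ Used, τ j ≠ j := fun j hj h =>
    disjoint_left.1 hdisj (hτ j hj) (h.symm ▸ hUP hj : τ j ∈ Pool) |>.elim
  -- the leader map
  let L : Fin n → Fin n := fun j => if j ∈ P ∪ T then a₀ else if j ∈ Used then τ j else j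
  have hL_PT : ∀ j ∈ P ∪ T, L j = a₀ := fun j hj => by
    show (if j ∈ P ∪ T then a₀ else if j ∈ Used then τ j else j) = a₀; rw [if_pos hj]
  have hL_U : ∀ j ∈ Used, L j = τ j := fun j hj => by
    show (if j ∈ P ∪ T then a₀ else if j ∈ Used then τ j else j) = τ j
    rw [if_neg (hUsed_notPT j hj), if_pos hj]
  have hL_o : ∀ j, j ∉ P ∪ T → j ∉ Used → L j = j := fun j h1 h2 => by
    show (if j ∈ P ∪ T then a₀ else if j ∈ Used then τ j else j) = j
    rw [if_neg h1, if_neg h2]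
  have hsa : s a₀ = s₀ := by simp [s]
  have hsX : ∀ x ∈ X, s x = z x := fun x hx => by simp [s, if_neg (hXa₀ x hx)]
  have hLa₀ : L a₀ = a₀ := hL_PT a₀ ha₀
  have hLX : ∀ x ∈ X, L x = x := fun x hx => hL_o x (hX_notPT x hx) fun h => hX_notPool x hx (hUP h)
  have hLTg : ∀ t ∈ Tg, L t = t := fun t ht => by
    rcases mem_insert.1 ht with rfl | ht
    · exact hLa₀
    · exact hLX t ht
  -- fibres: of the block leader, and of any other leader
  have hfib₀ : univ.filter (fun j => L j = a₀) = (P ∪ T) ∪ Used.filter (fun j => τ j = a₀) := by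
    ext j
    rw [mem_filter, mem_union, mem_filter]
    simp only [mem_univ, true_and]
    by_cases h1 : j ∈ P ∪ T
    · rw [hL_PT j h1]; exact ⟨fun _ => Or.inl h1, fun _ => rfl⟩
    · by_cases h2 : j ∈ Used
      · rw [hL_U j h2]
        exact ⟨fun h => Or.inr ⟨h2, h⟩, fun h => h.elim (fun h' => absurd h' h1) fun h' => h'.2⟩
      · rw [hL_o j h1 h2]
        refine ⟨fun h => absurd (by rw [h]; exact ha₀) h1, fun h => h.elim (fun h' => absurd h' h1) ?_⟩
        exact fun h' => absurd h'.1 h2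
  have hfib₁ : ∀ t, t ∉ P ∪ T → t ∉ Used →
      univ.filter (fun j => L j = t) = insert t (Used.filter (fun j => τ j = t)) := by
    intro t ht1 ht2
    ext j
    rw [mem_filter, mem_insert, mem_filter]
    simp only [mem_univ, true_and]
    by_cases h1 : j ∈ P ∪ T
    · rw [hL_PT j h1]
      constructor
      · intro h; exact absurd (by rw [← h]; exact ha₀) ht1
      · rintro (rfl | ⟨h, _⟩)
        · exact absurd h1 ht1
        · exact absurd h1 (hUsed_notPT j h)
    · by_cases h2 : j ∈ Used
      · rw [hL_U j h2]
        constructor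
        · intro h; exact Or.inr ⟨h2, h⟩
        · rintro (rfl | ⟨_, h⟩)
          · exact absurd h2 ht2
          · exact h
      · rw [hL_o j h1 h2]
        constructor
        · intro h; exact Or.inl h
        · rintro (h | ⟨h, _⟩)
          · exact h
          · exact absurd h h2
  -- the residual values of the targets
  have hres : ∀ t ∈ Tg, ∑ j ∈ univ.filter (fun j => L j = t), z j =
      s t + ∑ j ∈ Used.filter (fun j => τ j = t), z j := by
    intro t ht
    rcases mem_insert.1 ht with rfl | htX
    · rw [hfib₀, sum_union (disjoint_left.2 fun j hj hju => hUsed_notPT j (mem_filter.1 hju).1 hj),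
        sum_union (disjoint_left.2 fun j hj hjT => ?_)]
      · rw [hsa, hs₀def, hQdef]
      · exact disjoint_left.1 hdPN hj (hTN hjT)
    · rw [hfib₁ _ (hX_notPT _ htX) (fun h => hX_notPool _ htX (hUP h)),
        sum_insert (fun h => hX_notPool _ htX (hUP (mem_filter.1 h).1)), hsX _ htX]
  have hmassT : ∑ j ∈ T, |z j| = -(∑ j ∈ T, z j) := by
    rw [← sum_neg_distrib]
    exact sum_congr rfl fun j hj => abs_of_neg (by have := hNneg j (hTN hj); linarith)
  have hmassP : ∑ j ∈ P, |z j| = Q :=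
    sum_congr rfl fun j hj => abs_of_pos (by have := hPpos j hj; linarith)
  have hmassU : ∀ t,
      ∑ j ∈ Used.filter (fun j => τ j = t), |z j| = ∑ j ∈ Used.filter (fun j => τ j = t), z j :=
    fun t => sum_congr rfl fun j hj => abs_of_nonneg (hUsed0 j (mem_filter.1 hj).1)
  have hU0 : ∀ t, 0 ≤ ∑ j ∈ Used.filter (fun j => τ j = t), z j :=
    fun t => sum_nonneg fun j hj => hUsed0 j (mem_filter.1 hj).1
  refine ⟨L, fun i => ?_, fun i => ?_, fun i => ?_, ?_⟩
  · -- idempotent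
    by_cases h1 : i ∈ P ∪ T
    · rw [hL_PT i h1, hLa₀]
    · by_cases h2 : i ∈ Used
      · rw [hL_U i h2]; exact hLTg _ (hτ i h2)
      · rw [hL_o i h1 h2, hL_o i h1 h2]
  · -- masses
    by_cases hblk : L i = a₀
    · rw [hblk, hfib₀, sum_union (disjoint_left.2 fun j hj hju => hUsed_notPT j (mem_filter.1 hju).1 hj),
        sum_union (disjoint_left.2 fun j hj hjT => ?_), hmassP, hmassT, hmassU]
      · have h1 := (hprop a₀ (mem_insert_self a₀ X)).1
        rw [hsa, hs₀def] at h1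
        have h2 := hs₀lo
        rw [hs₀def] at h2
        linarith
      · exact disjoint_left.1 hdPN hj (hTN hjT)
    · -- leader `t = L i` is not the block leader, hence outside `P ∪ T` and `Used`
      set t := L i with htdef
      have ht1 : t ∉ P ∪ T := by
        intro h
        by_cases h1 : i ∈ P ∪ T
        · exact hblk (hL_PT i h1)
        · by_cases h2 : i ∈ Used
          · rw [htdef, hL_U i h2] at h
            have := hLTg _ (hτ i h2); rw [hL_PT _ h] at this
            exact hblk (by rw [htdef, hL_U i h2, ← this])
          · rw [htdef, hL_o i h1 h2] at h; exact h1 h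
      have ht2 : t ∉ Used := by
        intro h
        by_cases h1 : i ∈ P ∪ T
        · exact hblk (hL_PT i h1)
        · by_cases h2 : i ∈ Used
          · rw [htdef, hL_U i h2] at h
            exact disjoint_left.1 hdisj (hτ i h2) (hUP h)
          · rw [htdef, hL_o i h1 h2] at h; exact h2 h
      rw [hfib₁ t ht1 ht2, sum_insert (fun h => ht2 (mem_filter.1 h).1), hmassU]
      by_cases htX : t ∈ X
      · have h1 := (hprop t (mem_insert_of_mem htX)).1
        rw [hsX t htX] at h1
        have := hz t; have := abs_nonneg (z t)
        have : ∑ j ∈ Used.filter (fun j => τ j = t), z j ≤ |z t| := by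
          have := neg_abs_le (z t); linarith
        linarith
      · have hemp : Used.filter (fun j => τ j = t) = ∅ := by
          refine filter_false_of_mem fun j hj h => ?_
          have := hτ j hj; rw [h] at this
          rcases mem_insert.1 this with h' | h'
          · exact ht1 (h' ▸ ha₀)
          · exact htX h'
        rw [hemp, sum_empty, add_zero]
        have := hz t; linarith
  · -- values
    by_cases hblk : L i = a₀
    · rw [hblk, hres a₀ (mem_insert_self a₀ X), hsa]
      have h1 := (hprop a₀ (mem_insert_self a₀ X)).1
      have h2 := hU0 a₀
      rw [hsa] at h1
      rw [abs_le]; constructor <;> linarith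
    · set t := L i with htdef
      have ht1 : t ∉ P ∪ T := by
        intro h
        by_cases h1 : i ∈ P ∪ T
        · exact hblk (hL_PT i h1)
        · by_cases h2 : i ∈ Used
          · rw [htdef, hL_U i h2] at h
            have := hLTg _ (hτ i h2); rw [hL_PT _ h] at this
            exact hblk (by rw [htdef, hL_U i h2, ← this])
          · rw [htdef, hL_o i h1 h2] at h; exact h1 h
      have ht2 : t ∉ Used := by
        intro h
        by_cases h1 : i ∈ P ∪ T
        · exact hblk (hL_PT i h1)
        · by_cases h2 : i ∈ Used
          · rw [htdef, hL_U i h2] at h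
            exact disjoint_left.1 hdisj (hτ i h2) (hUP h)
          · rw [htdef, hL_o i h1 h2] at h; exact h2 h
      rw [hfib₁ t ht1 ht2, sum_insert (fun h => ht2 (mem_filter.1 h).1)]
      by_cases htX : t ∈ X
      · have h1 := (hprop t (mem_insert_of_mem htX)).1
        rw [hsX t htX] at h1
        have h2 := hU0 t
        have := hzlo t
        rw [abs_le]; constructor <;> linarith
      · have hemp : Used.filter (fun j => τ j = t) = ∅ := by
          refine filter_false_of_mem fun j hj h => ?_
          have := hτ j hj; rw [h] at this
          rcases mem_insert.1 this with h' | h'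
          · exact ht1 (h' ▸ ha₀)
          · exact htX h'
        rw [hemp, sum_empty, add_zero]; exact hz t
  · -- HOLD mass: stale leaders are targets; a stale target certifies that the pool is exhausted
    set St := univ.filter (fun i => L i = i ∧ (e : ℤ) < |∑ j ∈ univ.filter (fun j => L j = i), z j|)
      with hStdef
    have hStTg : St ⊆ Tg.filter (fun t => (e : ℤ) < |∑ j ∈ univ.filter (fun j => L j = t), z j|) := by
      intro i hi
      rw [mem_filter] at hi ⊢
      obtain ⟨_, hLi, hst⟩ := hi
      refine ⟨?_, hst⟩
      by_contra hiTg
      have hi1 : i ∉ P ∪ T := fun h => hiTg (by rw [← hLi, hL_PT i h]; exact mem_insert_self _ _)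
      have hi2 : i ∉ Used := fun h => hτne i h (by rw [← hL_U i h]; exact hLi)
      have hemp : Used.filter (fun j => τ j = i) = ∅ :=
        filter_false_of_mem fun j hj h => hiTg (h ▸ hτ j hj)
      rw [hfib₁ i hi1 hi2, hemp, insert_empty, sum_singleton] at hst
      -- `i` is a good: `|z i| ≤ e`
      have hiP : i ∉ P := fun h => hi1 (mem_union_left _ h)
      have hiN : i ∉ Nn := fun h =>
        hiTg (mem_insert_of_mem (mem_sdiff.2 ⟨h, fun h' => hi1 (mem_union_right _ h')⟩))
      rw [hP, mem_filter, not_and, not_lt] at hiP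
      rw [hNn, mem_filter, not_and, not_lt] at hiN
      exact not_lt.2 (abs_le.2 ⟨hiN (mem_univ i), hiP (mem_univ i)⟩) hst
    rcases (Tg.filter (fun t => (e : ℤ) < |∑ j ∈ univ.filter (fun j => L j = t), z j|)).eq_empty_or_nonempty
      with hemp | ⟨t₀, ht₀⟩
    · have hSt0 : St = ∅ := subset_empty.1 (by rw [hemp] at hStTg; exact hStTg)
      rw [hSt0, sum_empty]; exact abs_nonneg _
    · -- some target is stale, so the pool is exhausted
      obtain ⟨ht₀Tg, ht₀st⟩ := mem_filter.1 ht₀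
      have hexh : Used = Pool := by
        rcases (hprop t₀ ht₀Tg).2 with h | h
        · exfalso
          rw [hres t₀ ht₀Tg] at ht₀st
          have h1 := (hprop t₀ ht₀Tg).1
          rw [abs_of_nonpos h1] at ht₀st; linarith
        · exact h
      calc ∑ i ∈ St, |∑ j ∈ univ.filter (fun j => L j = i), z j|
          ≤ ∑ t ∈ Tg, |∑ j ∈ univ.filter (fun j => L j = t), z j| :=
            (sum_le_sum_of_subset_of_nonneg hStTg (fun _ _ _ => abs_nonneg _)).trans
              (sum_le_sum_of_subset_of_nonneg (filter_subset _ _) fun _ _ _ => abs_nonneg _)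
        _ = ∑ t ∈ Tg, -(s t + ∑ j ∈ Used.filter (fun j => τ j = t), z j) :=
            sum_congr rfl fun t ht => by rw [hres t ht, abs_of_nonpos (hprop t ht).1]
        _ = -(∑ t ∈ Tg, s t) - ∑ j ∈ Used, z j := by
            rw [sum_neg_distrib, sum_add_distrib, sum_fiberwise_of_maps_to (fun j hj => hτ j hj)]; ring
        _ = -(s₀ + ∑ x ∈ X, z x) - ∑ j ∈ Pool, z j := by
            rw [hexh, hTgdef, sum_insert ha₀X, hsa, sum_congr rfl hsX]
        _ = -(∑ j, z j) + ∑ j ∈ Gm, z j := by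
            rw [hsplit, hs₀def, hQdef, hXdef, sum_sdiff_eq_sub hTN]; ring
        _ ≤ |∑ j, z j| := by have := neg_abs_le (∑ j, z j); linarith

end Summit.ValiantsHypothesis.ValiantsHypothesis.Theorems.DepthWindow.TreeBias
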